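import Summits.Parity.GeneralizedHardyLittlewood.Theorems.VinogradovHeathBrownReadout

/-! # VinogradovHeathBrown (2/3) — A1, the main term: `mainTermLower_holds : MainTermLower` (item
stmt-Parity-19776 of `route-Parity-VinogradovHeathBrown`)

Ledger of record: tier A, ledger **FRONTIER**; no bearing on prime pairs / parity / GHL (tribunal J 2026-08-26).
For odd `N ≥ N₀`: `T(g_B, g_B, f₃) = ∑_π f₃(π) ∑_{n₁+n₂=N−π} g_B(n₁) g_B(n₂) ≥ c_M η² N²`, from the rough-pair
lower bound E6 (`roughModelPairCountLower_holds`, Literature) at the even numbers `m = N − π ∈ [N/4, N/2)` and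
Heath-Brown's count `π(𝒜)(X, η) ≥ κ η² X²/log X` taken as the displayed hypothesis (`c_M = (3/8)·6^{−2/3} κ c₀`).
Sources: [HeathBrownActa2001] (Theorem 1), [Nathanson1996] (§8), [Vinogradov1937].

Theorems-side PORT of the cell evidence `pub/parity-ideate/parity-ideate-p2/evidence/LineEFG_tree.lean`
(KERNEL-PROVED there, farm rc 0, axioms std), re-namespaced into the route namespace (precedent
`Theorems/MaynardProductExactGlue.lean`) and re-based on the LANDED Literature modules `CubicMinorantDefs`
(p407241: the weights `vmWeight`, `gWeight`, `hbWeight`, `apWeight`, `ternarySum`, `expSumOf`),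
`TernaryHolderCounting` (E5, p410251), `RoughModelPairCount` (E6, p410680), `RoughModelFourierApprox`
(E2, p410505), `HeathBrownWeightFourthMoment` (E4b, p410644), whose public lemmas replace the evidence's local
copies. Notation: `T = ternarySum`, `Λ_N = vmWeight N`, `g_B = gWeight B N` (the `W`-rough model of level
`(log N)^B` on `[1, N]`), `f₃ = hbWeight c N` (Heath-Brown primes `x³+2y³` from the box
`X < x, y ≤ X(1+η)`, `X = (N/6)^{1/3}`, `η = (log X)^{-c}`, weight `N^{1/3} log`). Port prepared and
farm-checked by parity-ideate-p2 g5 (planner); filed by a prover seat. -/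

noncomputable section

open scoped FourierTransform ArithmeticFunction
open Finset MeasureTheory Filter

namespace Summit.Parity.GeneralizedHardyLittlewood.Theses.VinogradovHeathBrown

open Literature.NumberTheory.Sieve Literature.NumberTheory.Sieve.CubicPrimes
open Literature.NumberTheory.Sieve.CubicMinorant hiding RoughModelFourierApprox HBFourierFourthMoment
  roughModelFourierApprox_holds hbFourierFourthMoment_holds
open Literature.NumberTheory.Waring.HuaCubes

section MainTermProof

open scoped Topology

/-- the rough-model weight `g_B` restricted to `[1, N]` is non-negative. [folklore] -/
theorem gWeight_nonneg (B : ℝ) (N n : ℕ) : 0 ≤ gWeight B N n := by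
  unfold gWeight; split_ifs; exacts [roughModel_nonneg B N n, le_rfl]

/-- Values of box pairs: `x³ + 2y³ ≤ 3N/4` once `η ≤ 1/10` (`(1.1)³ · 3 · (N/6) < 3N/4`). [this line] -/
theorem value_le_of_mem_primePairs {c : ℝ} {N : ℕ} (hη : hbEta c N ≤ 1 / 10) {x y : ℕ}
    (h : (x, y) ∈ primePairs (hbX N) (hbEta c N)) :
    ((x ^ 3 + 2 * y ^ 3 : ℕ) : ℝ) ≤ 3 * N / 4 := by
  rw [mem_primePairs_iff] at h
  obtain ⟨-, hx, -, hy, -, -⟩ := h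
  have hX0 := hbX_nonneg N
  have hN0 : (0 : ℝ) ≤ N := Nat.cast_nonneg N
  have hx' : (x : ℝ) ≤ hbX N * (11 / 10) := hx.trans (by nlinarith)
  have hy' : (y : ℝ) ≤ hbX N * (11 / 10) := hy.trans (by nlinarith)
  have hx3 : (x : ℝ) ^ 3 ≤ (hbX N * (11 / 10)) ^ 3 := by gcongr
  have hy3 : (y : ℝ) ^ 3 ≤ (hbX N * (11 / 10)) ^ 3 := by gcongr
  have hX3 : (hbX N * (11 / 10)) ^ 3 = (N : ℝ) / 6 * (1331 / 1000) := by
    rw [mul_pow, hbX_pow_three]; norm_num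
  rw [hX3] at hx3 hy3
  push_cast
  linarith

/-- no Heath-Brown box pair has value `> 3N/4` once `η ≤ 1/10`. [this line; HeathBrownActa2001 Thm 1 (the box)] -/
theorem hbRep_eq_zero_of_gt {c : ℝ} {N n : ℕ} (hη : hbEta c N ≤ 1 / 10)
    (hn : (3 : ℝ) * N / 4 < n) : hbRep c N n = 0 := by
  rw [hbRep, Finset.card_eq_zero, Finset.filter_eq_empty_iff]
  rintro ⟨x, y⟩ hxy hval
  have h := value_le_of_mem_primePairs hη hxy
  simp only at hval
  rw [hval] at h
  linarith

/-- All box values are `≤ N`, so `∑_{m ≤ N} hbRep(m) = π(𝒜)(X, η)`. [this line] -/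
theorem sum_hbRep_eq {c : ℝ} {N : ℕ} (hη : hbEta c N ≤ 1 / 10) :
    ∑ m ∈ range (N + 1), hbRep c N m = primePairCount (hbX N) (hbEta c N) := by
  unfold hbRep
  rw [primePairCount_def, Finset.sum_card_fiberwise_eq_card_filter]
  congr 1
  apply Finset.filter_true_of_mem
  rintro ⟨x, y⟩ hxy
  rw [mem_range, Nat.lt_succ_iff]
  have h := value_le_of_mem_primePairs hη hxy
  have hN : (0 : ℝ) ≤ N := Nat.cast_nonneg N
  have : ((x ^ 3 + 2 * y ^ 3 : ℕ) : ℝ) ≤ N := h.trans (by linarith)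
  exact_mod_cast this

/-- Regrouping the ternary sum over `n₃`, as a lower bound (all weights non-negative):
`T(g, g, f₃) ≥ ∑_{n₃ ≤ N} f₃(n₃) ∑_{1 ≤ n₁ ≤ N − n₃ − 1} g(n₁) g(N − n₃ − n₁)` — inject
`(n₃, n₁) ↦ (n₁, N − n₃ − n₁, n₃)`. [folklore] -/
theorem ternarySum_ge_fibre (g f₃ : ℕ → ℝ) (hg : ∀ n, 0 ≤ g n) (hf : ∀ n, 0 ≤ f₃ n) (N : ℕ) :
    ∑ n₃ ∈ range (N + 1), f₃ n₃ * ∑ n₁ ∈ Icc 1 (N - n₃ - 1), g n₁ * g (N - n₃ - n₁) ≤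
      ternarySum g g f₃ N := by
  classical
  set P := (range (N + 1) ×ˢ Icc 1 N).filter (fun p : ℕ × ℕ => p.1 + p.2 + 1 ≤ N) with hP
  set e : ℕ × ℕ → (Fin 3 → ℕ) := fun p => ![p.2, N - p.1 - p.2, p.1] with he
  have hG : ∀ t : Fin 3 → ℕ, 0 ≤ g (t 0) * g (t 1) * f₃ (t 2) := fun t =>
    mul_nonneg (mul_nonneg (hg _) (hg _)) (hf _)
  have hL : ∑ n₃ ∈ range (N + 1), f₃ n₃ * ∑ n₁ ∈ Icc 1 (N - n₃ - 1), g n₁ * g (N - n₃ - n₁) =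
      ∑ p ∈ P, g (e p 0) * g (e p 1) * f₃ (e p 2) := by
    rw [hP, Finset.sum_filter, Finset.sum_product]
    refine Finset.sum_congr rfl fun n₃ _ => ?_
    have hI : Icc 1 (N - n₃ - 1) = (Icc 1 N).filter (fun n₁ => n₃ + n₁ + 1 ≤ N) := by
      ext n₁; simp only [mem_Icc, mem_filter]; omega
    rw [hI, Finset.sum_filter, Finset.mul_sum]
    refine Finset.sum_congr rfl fun n₁ _ => ?_
    simp [he]
    split_ifs <;> ring
  have hinj : Set.InjOn e ↑P := by
    intro p _ p' _ h
    have h0 := congr_fun h 0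
    have h2 := congr_fun h 2
    simp [he] at h0 h2
    exact Prod.ext h2 h0
  have hsub : P.image e ⊆ Finset.Nat.antidiagonalTuple 3 N := by
    intro t ht
    obtain ⟨p, hp, rfl⟩ := Finset.mem_image.mp ht
    rw [hP, Finset.mem_filter] at hp
    rw [Finset.Nat.mem_antidiagonalTuple, Fin.sum_univ_three]
    simp [he]
    omega
  rw [hL, ← Finset.sum_image (f := fun t : Fin 3 → ℕ => g (t 0) * g (t 1) * f₃ (t 2)) hinj]
  exact Finset.sum_le_sum_of_subset_of_nonneg hsub fun t _ _ => hG t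

/-- **A1 PROVED**, with `c_M = c₀ κ / 32` (`c₀ = 1/16` from E6). [this line] -/
theorem mainTermLower_holds : MainTermLower := by
  intro c hc κ hκ hHB B hB
  obtain ⟨c₀, hc₀, N₆, h6⟩ := roughModelPairCountLower_holds B hB
  refine ⟨c₀ * κ / 32, by positivity, ?_⟩
  have hev1 := tendsto_hbX.eventually hHB
  have hev2 : ∀ᶠ N : ℕ in atTop, hbEta c N ≤ 1 / 10 :=
    ((tendsto_hbEta hc).eventually (gt_mem_nhds (by norm_num : (0 : ℝ) < 1 / 10))).mono
      fun N h => h.le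
  obtain ⟨N₅, hN₅⟩ := Filter.eventually_atTop.1 (hev1.and (hev2.and (eventually_gt_atTop 6)))
  refine ⟨N₅ + N₆, fun N hN hodd => ?_⟩
  obtain ⟨hPP, hη, hN6⟩ := hN₅ N (by omega)
  change κ * (hbEta c N ^ 2 * hbX N ^ 2 / Real.log (hbX N)) ≤
    (primePairCount (hbX N) (hbEta c N) : ℝ) at hPP
  obtain ⟨hX1, hLX, hLXle⟩ := hbX_facts hN6
  have hN0 : (0 : ℝ) < N := by exact_mod_cast (show 0 < N by omega)
  have hLN : 0 < Real.log N := Real.log_pos (by exact_mod_cast (show 1 < N by omega))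
  have hη0 : 0 ≤ hbEta c N := Real.rpow_nonneg hLX.le _
  -- Step 1: regroup over `n₃`
  have hfib := ternarySum_ge_fibre (gWeight B N) (hbWeight c N) (gWeight_nonneg B N)
    (hbWeight_nonneg c N) N
  -- Step 2: E6 on each fibre with `f₃(n₃) ≠ 0`
  have hstep2 : ∑ n₃ ∈ range (N + 1), hbWeight c N n₃ * (c₀ * N / 4) ≤
      ∑ n₃ ∈ range (N + 1), hbWeight c N n₃ *
        ∑ n₁ ∈ Icc 1 (N - n₃ - 1), gWeight B N n₁ * gWeight B N (N - n₃ - n₁) := by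
    refine Finset.sum_le_sum fun n₃ _ => ?_
    by_cases hr : hbRep c N n₃ = 0
    · simp [hbWeight, hr]
    · refine mul_le_mul_of_nonneg_left ?_ (hbWeight_nonneg c N n₃)
      obtain ⟨x, y, hx, hy, hp, hval, hlt⟩ := exists_of_hbRep_ne_zero hr
      have h34 : (n₃ : ℝ) ≤ 3 * N / 4 := by
        by_contra h; exact hr (hbRep_eq_zero_of_gt hη (lt_of_not_ge h))
      have hn₃N : n₃ ≤ N := by
        have : (n₃ : ℝ) ≤ N := h34.trans (by linarith)
        exact_mod_cast this
      have hm_even : Even (N - n₃) := by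
        have hp3 : n₃.Prime := hval ▸ hp
        exact Nat.Odd.sub_odd hodd (hp3.odd_of_ne_two (by omega))
      have hm_lo : (N : ℝ) / 4 ≤ ((N - n₃ : ℕ) : ℝ) := by
        rw [Nat.cast_sub hn₃N]; linarith
      have h6m := h6 N (by omega) (N - n₃) hm_even hm_lo (Nat.sub_le N n₃)
      have hsum : ∑ n ∈ Icc 1 (N - n₃ - 1), roughModel B N n * roughModel B N (N - n₃ - n) =
          ∑ n₁ ∈ Icc 1 (N - n₃ - 1), gWeight B N n₁ * gWeight B N (N - n₃ - n₁) := by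
        refine Finset.sum_congr rfl fun n₁ hn₁ => ?_
        rw [mem_Icc] at hn₁
        have h1 : n₁ ∈ Icc 1 N := by rw [mem_Icc]; omega
        have h2 : N - n₃ - n₁ ∈ Icc 1 N := by rw [mem_Icc]; omega
        simp only [gWeight, if_pos h1, if_pos h2]
      calc c₀ * N / 4 ≤ c₀ * ((N - n₃ : ℕ) : ℝ) := by
            have := mul_le_mul_of_nonneg_left hm_lo hc₀.le; linarith
        _ ≤ _ := by rw [← hsum]; exact h6m
  -- Step 3: the mass `∑ f₃ ≥ (κ/8) η² N`
  have hcube : ((N : ℝ) ^ ((1 : ℝ) / 3)) ^ 3 = N := by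
    rw [← Real.rpow_natCast, ← Real.rpow_mul hN0.le]; norm_num
  have hmass : κ / 8 * hbEta c N ^ 2 * N ≤ ∑ n₃ ∈ range (N + 1), hbWeight c N n₃ := by
    have h1 : ∑ n₃ ∈ range (N + 1), (N : ℝ) ^ ((1 : ℝ) / 3) * (Real.log N / 2) * (hbRep c N n₃ : ℝ) ≤
        ∑ n₃ ∈ range (N + 1), hbWeight c N n₃ := by
      refine Finset.sum_le_sum fun n₃ _ => ?_
      by_cases hr : hbRep c N n₃ = 0
      · simp [hbWeight, hr]
      · unfold hbWeight
        refine mul_le_mul_of_nonneg_right (mul_le_mul_of_nonneg_left ?_ (by positivity))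
          (Nat.cast_nonneg _)
        obtain ⟨x, y, -, -, -, -, hlt⟩ := exists_of_hbRep_ne_zero hr
        have hn₃ : (N : ℝ) / 2 ≤ n₃ := by
          have : (N : ℝ) < 2 * n₃ := by exact_mod_cast hlt
          linarith
        have hlog2 : Real.log ((N : ℝ) / 2) = Real.log N - Real.log 2 :=
          Real.log_div hN0.ne' two_ne_zero
        have hlog4 : Real.log 4 ≤ Real.log N :=
          Real.log_le_log (by norm_num) (by exact_mod_cast (show 4 ≤ N by omega))
        have hlog4' : Real.log 4 = 2 * Real.log 2 := by
          rw [show (4 : ℝ) = 2 ^ 2 by norm_num, Real.log_pow]; push_cast; ring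
        calc Real.log N / 2 ≤ Real.log N - Real.log 2 := by linarith
          _ = Real.log ((N : ℝ) / 2) := hlog2.symm
          _ ≤ Real.log n₃ := Real.log_le_log (by positivity) hn₃
    have h2 : ∑ n₃ ∈ range (N + 1), (hbRep c N n₃ : ℝ) = primePairCount (hbX N) (hbEta c N) := by
      exact_mod_cast sum_hbRep_eq hη
    rw [← Finset.mul_sum, h2] at h1
    have h3 : κ * (hbEta c N ^ 2 * hbX N ^ 2 / Real.log N) ≤
        primePairCount (hbX N) (hbEta c N) :=
      le_trans (mul_le_mul_of_nonneg_left
        (div_le_div_of_nonneg_left (by positivity) hLX hLXle) hκ.le) hPP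
    have hXlo : (N : ℝ) ^ ((1 : ℝ) / 3) / 2 ≤ hbX N := by
      by_contra h
      rw [not_le] at h
      have hX0 := hbX_nonneg N
      have hlt3 : hbX N ^ 3 < ((N : ℝ) ^ ((1 : ℝ) / 3) / 2) ^ 3 := by gcongr
      rw [hbX_pow_three, div_pow, hcube] at hlt3
      norm_num at hlt3
      linarith
    have hNX : (N : ℝ) / 4 ≤ (N : ℝ) ^ ((1 : ℝ) / 3) * hbX N ^ 2 := by
      have h0 : 0 ≤ (N : ℝ) ^ ((1 : ℝ) / 3) / 2 := by positivity
      calc (N : ℝ) / 4 = ((N : ℝ) ^ ((1 : ℝ) / 3)) ^ 3 / 4 := by rw [hcube]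
        _ = (N : ℝ) ^ ((1 : ℝ) / 3) * ((N : ℝ) ^ ((1 : ℝ) / 3) / 2) ^ 2 := by ring
        _ ≤ (N : ℝ) ^ ((1 : ℝ) / 3) * hbX N ^ 2 := by gcongr
    have h4 : (N : ℝ) ^ ((1 : ℝ) / 3) * (Real.log N / 2) *
        (κ * (hbEta c N ^ 2 * hbX N ^ 2 / Real.log N)) =
        κ / 2 * hbEta c N ^ 2 * ((N : ℝ) ^ ((1 : ℝ) / 3) * hbX N ^ 2) := by
      field_simp
    calc κ / 8 * hbEta c N ^ 2 * N = κ / 2 * hbEta c N ^ 2 * ((N : ℝ) / 4) := by ring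
      _ ≤ κ / 2 * hbEta c N ^ 2 * ((N : ℝ) ^ ((1 : ℝ) / 3) * hbX N ^ 2) := by gcongr
      _ = (N : ℝ) ^ ((1 : ℝ) / 3) * (Real.log N / 2) *
            (κ * (hbEta c N ^ 2 * hbX N ^ 2 / Real.log N)) := h4.symm
      _ ≤ (N : ℝ) ^ ((1 : ℝ) / 3) * (Real.log N / 2) * primePairCount (hbX N) (hbEta c N) :=
          mul_le_mul_of_nonneg_left h3 (by positivity)
      _ ≤ _ := h1
  -- Step 4: combine
  have hfinal : ∑ n₃ ∈ range (N + 1), hbWeight c N n₃ * (c₀ * N / 4) =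
      (c₀ * N / 4) * ∑ n₃ ∈ range (N + 1), hbWeight c N n₃ := by
    rw [Finset.mul_sum]; exact Finset.sum_congr rfl fun _ _ => mul_comm _ _
  calc c₀ * κ / 32 * hbEta c N ^ 2 * (N : ℝ) ^ 2
      = (c₀ * N / 4) * (κ / 8 * hbEta c N ^ 2 * N) := by ring
    _ ≤ (c₀ * N / 4) * ∑ n₃ ∈ range (N + 1), hbWeight c N n₃ :=
        mul_le_mul_of_nonneg_left hmass (by positivity)
    _ = ∑ n₃ ∈ range (N + 1), hbWeight c N n₃ * (c₀ * N / 4) := hfinal.symm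
    _ ≤ _ := hstep2
    _ ≤ _ := hfib

end MainTermProof

end Summit.Parity.GeneralizedHardyLittlewood.Theses.VinogradovHeathBrown

end
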